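import Summits.BirchSwinnertonDyer.BirchSwinnertonDyer.Theses.ErratumRoadFive
import Summits.BirchSwinnertonDyer.BirchSwinnertonDyer.Theorems.ErratumRoadFiveJSWSigmaLocalCharIdeal
import HarnessLib

/-!
# v6 — BC3 skeleton of crux `IMCDivAtErratumDataAllR` (item stmt-BirchSwinnertonDyer-20169, K2 Road FF) AFTER the route-level
# E-FREE OPEN INPUT edit (ER5 rev 45, PROPOSAL (γ) = K2RF token 2, director-bsd RULING W-75, 2026-08-28): the ONE OPEN stub is the
# route's NEW CRUX `ErratumThm23SigmaLe` BY NAME (plan g39; supersedes v5 of imc-p1 g15 and the registered v4-B birth of plan g33)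

ROAD FF (Castella 2018 erratum (2.4)♭: `Ch_Λ(X_ac)_{𝔭bar} · Λ^ur ⊆ (L_{𝔭_{ι′}})` at every erratum datum). The registered birth (v4-B, plan
g33) carried ONE OPEN stub = the member PACKAGE O15 (item 20529 `CastellaErratumMemberPackage`, now ASIDE). After the F-split (imc-p1
g15: F4♯ `Castella2018.erratumThm23_charIdeal_sigma_le_of_isTorsion_OPEN` + F3♯ `Castella2018.erratum_exists_frames_members_sigma_
congruence`, receptacle `𝓞_{ℂ_p}⟦T⟧`) and the route edits DROP-JSW (rev 41: Σ-data from the CLOSED local atom 20495 + conjuncts of 19283,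
no JSW17 3.3.1) ∕ DROP-WU (rev 43) ∕ E-FREE OPEN INPUT (rev 45: items `ErratumThm23SigmaLe` := F4♯ (crux, rank 2) and
`ErratumHidaMemberFrames` := F3♯ (support)), this skeleton is the route's own `have h3` line of `closes` cut into stubs:
* `stub_roadFF_thm23` — THE OPEN INPUT = the route crux **`Theses.ErratumRoadFive.ErratumThm23SigmaLe`** BY NAME (erratum Thm. 2.3 «⊂»
  for ONE `p`-ordinary crystalline newform over `K`, Σ-imprimitive — the erratum's use of [FW21, Thm. 4.41]; UNREFEREED; never proved here);
* `stub_roadFF_pubInputsR` — PUBLISHED inputs BY ITEM NAME: support `Theses.ErratumRoadFive.ErratumHidaMemberFrames` (F3♯: Cas18 Thm. 3.1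
  frame, Ski16 §2.6 members + erratum fn. 1, Cas20 Thm. 2.11 ∕ Cas18 (4.1) congruence) ∧ support `Theses.ErratumRoadFive.
  PublishedInputsIMCReduction` (item 19283; only its conjuncts 2, 4, 13, 14 = GZK, modularity, SU14 Prop. 3.2.3-type decomposition inputs are
  consumed);
while the Σ-data (CLOSED item 20495 `JSWSigmaLocalCharIdeal` by the tree theorem `jswSigmaLocalCharIdeal_holds` + Shapiro) and the two-slot
Fitting congruence frame (`P2.RoadFF.fittingCongruenceFrameAtErratumDataB_of_thm23_OPEN_of_frames`, p592527) are CLOSED INSIDE.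
`IMCDivAtErratumDataAllR_of` concludes the ROUTE decl by name, sorry-free; its body is the `have h3` line of `closes` rev 45 verbatim.
HONEST FRAMING: the crux is REDUCED to citation modulo ONE OPEN, UNREFEREED one-newform statement (now a route crux of its own, to be
attacked by the `complete` lens: [FW21 4.41] two-variable divisibility + App. B factorisation + [JSW17 3.4.2] descent + [Hsi14 B], typed) +
published inputs; nothing is proved about any curve; BSD is proved for no pair; no census number moves (T7).
[claim: Castella2018Erratum, status: under-review] [claim: FouquetWan2021, status: under-review]
-/

set_option autoImplicit false

noncomputable section

set_option linter.dupNamespace false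

namespace Summit.BirchSwinnertonDyer.BirchSwinnertonDyer.Cruxes.IMCDivAtErratumDataAllR.V6

/-- Stub T (THE OPEN INPUT, BY ROUTE-ITEM NAME): crux `ErratumThm23SigmaLe` = Castella's erratum Thm. 2.3 «⊂» (2.5), Σ-imprimitive, for
ONE `p`-ordinary crystalline newform over `K` (F4♯) — the erratum's use of [FW21, Thm. 4.41]; UNREFEREED; never proved here.
[claim: Castella2018Erratum, status: under-review] [claim: FouquetWan2021, status: under-review] -/
theorem stub_roadFF_thm23 : Summit.BirchSwinnertonDyer.BirchSwinnertonDyer.Theses.ErratumRoadFive.ErratumThm23SigmaLe := by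
  sorry

/-- Stub 0 (PUB INPUTS of Road FF, BY ROUTE-ITEM NAME): the published member data with frames (support `ErratumHidaMemberFrames` = F3♯)
and the published IMC-reduction inputs (support item 19283; conjuncts 2, 4, 13, 14 consumed). Closes by name only (published facts).
[cite: Castella2018Erratum, proof of Thm. 1.1 (a)(b)(c), footnote 1] [cite: Castella2020JIMJ, Thm. 2.11]
[cite: SkinnerUrban2014, Prop. 3.2.3] -/
theorem stub_roadFF_pubInputsR :
    Summit.BirchSwinnertonDyer.BirchSwinnertonDyer.Theses.ErratumRoadFive.ErratumHidaMemberFrames ∧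
      Summit.BirchSwinnertonDyer.BirchSwinnertonDyer.Theses.ErratumRoadFive.PublishedInputsIMCReduction := by
  sorry

/-! ## Stub statements by name -/

namespace Statement

/-- Statement of `stub_roadFF_thm23`. -/
abbrev stub_roadFF_thm23 : Prop := type_of% @V6.stub_roadFF_thm23
/-- Statement of `stub_roadFF_pubInputsR`. -/
abbrev stub_roadFF_pubInputsR : Prop := type_of% @V6.stub_roadFF_pubInputsR

end Statement

/-! ## The composition (sorry-free): the stub STATEMENTS imply the crux, BY NAME (route decl) -/

/-- **`IMCDivAtErratumDataAllR_of`** — Road FF after the E-FREE OPEN INPUT edit: Σ-data (closed inside: local atom theorem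
`jswSigmaLocalCharIdeal_holds` + SU14 Prop. 3.2.3 decomposition + conjuncts of 19283) and the two-slot Fitting congruence frame (closed
inside from the crux F4♯ + support F3♯) give the B-atom at every pair via the cut `P2.imcDivIntCoreFrameAtErratumDataB_of_roadFF_fitting`
— the `have h3` line of `closes` (ER5 rev 45) verbatim. -/
theorem IMCDivAtErratumDataAllR_of (hT : Statement.stub_roadFF_thm23) (hpub : Statement.stub_roadFF_pubInputsR) :
    Summit.BirchSwinnertonDyer.BirchSwinnertonDyer.Theses.ErratumRoadFive.IMCDivAtErratumDataAllR := by
  obtain ⟨hMF, hF⟩ := hpub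
  have hloc : Summit.BirchSwinnertonDyer.BirchSwinnertonDyer.Theses.ErratumRoadFive.JSWSigmaLocalCharIdeal :=
    Summit.BirchSwinnertonDyer.BirchSwinnertonDyer.Theorems.jswSigmaLocalCharIdeal_holds
  exact fun W _ _ p _ ↦
    Summit.BirchSwinnertonDyer.Rank1Residual.X11b.P2.imcDivIntCoreFrameAtErratumDataB_of_roadFF_fitting
      (Summit.BirchSwinnertonDyer.Rank1Residual.X11b.P2.RoadFF.sigmaDataAtErratumDataB_of_sigmaLocal_of_prop323_of_facts
        W p hloc Literature.NumberTheory.EllipticCurves.SkinnerUrban2014.prop323_XAc_equiv_XBigDecomp_holds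
        hF.2.1 hF.2.2.2.1 hF.2.2.2.2.2.2.2.2.2.2.2.2.1 hF.2.2.2.2.2.2.2.2.2.2.2.2.2.1)
      (Summit.BirchSwinnertonDyer.Rank1Residual.X11b.P2.RoadFF.fittingCongruenceFrameAtErratumDataB_of_thm23_OPEN_of_frames
        hT hMF W p)

/-- The crux along this line, MODULO exactly the by-name stubs (sorries only in `stub_roadFF_thm23`, `stub_roadFF_pubInputsR`). -/
theorem IMCDivAtErratumDataAllR_proof :
    Summit.BirchSwinnertonDyer.BirchSwinnertonDyer.Theses.ErratumRoadFive.IMCDivAtErratumDataAllR :=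
  IMCDivAtErratumDataAllR_of stub_roadFF_thm23 stub_roadFF_pubInputsR

end Summit.BirchSwinnertonDyer.BirchSwinnertonDyer.Cruxes.IMCDivAtErratumDataAllR.V6

end
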